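import Literature.Geometry.Lorentzian.CoordRicciPerturbation
import Literature.Geometry.Lorentzian.CoordChristoffelDerivative
import Literature.Geometry.Lorentzian.CoordCylinderFunctional
import Literature.Geometry.Lorentzian.ConformalCoordCurvature
import HarnessLib

/-!
# The `C`-normalization of a cylinder family in coordinates: the pointwise estimate
# (Bär–Hanke 2023, §3, Prop. 23, endpoint version)

Coordinate tensor calculus (`CoordCurvature.lean` ff.), in support of the proof programme of
`Literature.Geometry.Riemannian.BaerHankePscGluing`. For the slices `g_t` (components `G t`) of
a generalized cylinder the scalar curvature is (Bär–Hanke (9), coordinates, printed form)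

  `𝒮 = scalAt (G t) x + 3 |½h|² − (tr ½h)² − tr ḣ`,   `h = ġ_t`, `ḣ = g̈_t`.

Bär–Hanke's Prop. 23 deforms `g_t` near `t = 0` into a `C`-normal family; in the endpoint
version used by the tree the deformed family is `g^A_t = g_t + θ(t) w_t` with
`w_t = 2g_0 − g_t − g_{−t} − C t² g_0 = O((1 + C) t²)` and a logarithmic cutoff `θ`
(`|t θ'|, |t² θ''| ≤ η`), so that at a point: the `2`-jet in `x` moves by `O((1+C)t²)`, `h` by
`O((1+C) t)`, and `ḣ` by `O(η (1+C)) + θ (−ḣ_t − ḣ_{−t} − 2C g_0)`. This file proves the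
resulting **pointwise inequality** with explicit constants:

* `norm_sharpAt_le_two_mul_of_small` — `‖♯'‖ ≤ 2 ‖♯‖` when `‖♯‖ ‖G − G'‖ ≤ ½`;
* `opNorm_ricAt_le`, `opNorm_ricAt_sub_le` — operator-norm forms of the tree's Ricci bounds
  (`IsMetricOn.abs_ricAt_le`, `IsMetricOn.abs_ricAt_sub_le`);
* `stepA_pointwise` — **the estimate**: under the smallness conditions `4b²(1+C)t² ≤ 1`,
  `(1+C)t ≤ 1`, `40 b² t ≤ 1` and the perturbation sizes above (with a common bound `b ≥ 1` for
  `‖♯‖, ‖DG‖, ‖D²G‖, ‖h‖, ‖ḣ‖`),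
  `𝒮^A ≥ 𝒮 − 8500 n² b⁸ (1 + C)(t + η) + θ (C n − 4 n b²)`.

Everything is proved; no definitions, no named facts (D-0026).

## References

* C. Bär, B. Hanke, *Boundary conditions for scalar curvature*, arXiv:2012.09127, §3, Prop. 23
  and (9). [BarHanke2023]
* B. Kotschwar, Comm. Anal. Geom. 22 (2014), §1.1 (5)–(8) (the `C²` perturbation estimate).
  [Kotschwar2014]
-/

noncomputable section

set_option maxSynthPendingDepth 3

open Set Filter ContinuousLinearMap Module
open scoped Topology ContDiff RealInnerProductSpace

namespace Literature.Geometry.Lorentzian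

namespace MetricCoord

variable {E : Type*} [NormedAddCommGroup E] [InnerProductSpace ℝ E] [FiniteDimensional ℝ E]
  [CompleteSpace E] {G G' : E → E →L[ℝ] E →L[ℝ] ℝ} {V : Set E} {x : E}

/-! ### Norm helpers -/

omit [FiniteDimensional ℝ E] [CompleteSpace E] in
/-- **`‖♯'‖ ≤ 2‖♯‖` for a small perturbation**: if `‖♯_G‖ ‖G x − G' x‖ ≤ ½` then
`‖♯_{G'}‖ ≤ 2 ‖♯_G‖` (from `‖♯ − ♯'‖ ≤ ‖♯‖ ‖G − G'‖ ‖♯'‖`). [cite: Kotschwar2014, §1.1 (5)] -/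
theorem norm_sharpAt_le_two_mul_of_small (hi : (G x).IsInvertible) (hi' : (G' x).IsInvertible)
    (hsmall : ‖sharpAt G x‖ * ‖G x - G' x‖ ≤ 2⁻¹) :
    ‖sharpAt G' x‖ ≤ 2 * ‖sharpAt G x‖ := by
  have h := norm_sharpAt_sub_le hi hi'
  have h1 : ‖sharpAt G' x‖ ≤ ‖sharpAt G x‖ + ‖sharpAt G x - sharpAt G' x‖ := by
    have := norm_sub_le_norm_sub_add_norm_sub (sharpAt G' x) (sharpAt G x) 0
    simp only [sub_zero] at this
    rw [norm_sub_rev] at this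
    linarith
  have h2 : ‖sharpAt G x - sharpAt G' x‖ ≤ 2⁻¹ * ‖sharpAt G' x‖ := by
    calc ‖sharpAt G x - sharpAt G' x‖ ≤ ‖sharpAt G x‖ * ‖G x - G' x‖ * ‖sharpAt G' x‖ := h
      _ ≤ 2⁻¹ * ‖sharpAt G' x‖ := by gcongr
  linarith

/-- **Operator-norm bound on the Ricci form**: with `‖♯‖, ‖DG‖, ‖D²G‖ ≤ b` (`b ≥ 1`),
`‖Ric‖ ≤ 11 n b⁴`. [cite: ONeill1983, Ch. 3, Lemma 3.52] -/
theorem opNorm_ricAt_le (hG : IsMetricOn G V) (hx : x ∈ V) {b : ℝ} (hb : 1 ≤ b)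
    (hs : ‖sharpAt G x‖ ≤ b) (h1 : ‖fderiv ℝ G x‖ ≤ b) (h2 : ‖fderiv ℝ (fderiv ℝ G) x‖ ≤ b) :
    ‖ricAt G x‖ ≤ 11 * Module.finrank ℝ E * b ^ 4 := by
  have hb0 : 0 ≤ b := zero_le_one.trans hb
  have hn0 : (0 : ℝ) ≤ Module.finrank ℝ E := Nat.cast_nonneg _
  have hs0 := norm_nonneg (sharpAt G x)
  have h10 := norm_nonneg (fderiv ℝ G x)
  have h20 := norm_nonneg (fderiv ℝ (fderiv ℝ G) x)
  set M : ℝ := (2 * (2⁻¹ * (3 * (‖sharpAt G x‖ ^ 2 * ‖fderiv ℝ G x‖ ^ 2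
      + ‖sharpAt G x‖ * ‖fderiv ℝ (fderiv ℝ G) x‖)))
    + 2 * (2⁻¹ * (‖sharpAt G x‖ * (3 * ‖fderiv ℝ G x‖))) ^ 2) with hM
  have hMle : M ≤ 11 * b ^ 4 := by
    have e1 : ‖sharpAt G x‖ ^ 2 * ‖fderiv ℝ G x‖ ^ 2 ≤ b ^ 2 * b ^ 2 := by gcongr
    have e2 : ‖sharpAt G x‖ * ‖fderiv ℝ (fderiv ℝ G) x‖ ≤ b * b := by gcongr
    have e3 : ‖sharpAt G x‖ * (3 * ‖fderiv ℝ G x‖) ≤ b * (3 * b) := by gcongr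
    have e3' : (2⁻¹ * (‖sharpAt G x‖ * (3 * ‖fderiv ℝ G x‖))) ^ 2 ≤ (2⁻¹ * (b * (3 * b))) ^ 2 := by
      gcongr
    have hb2 : b * b ≤ b ^ 4 := by
      calc b * b = b ^ 2 * 1 := by ring
        _ ≤ b ^ 2 * b ^ 2 := by gcongr; exact one_le_pow₀ hb
        _ = b ^ 4 := by ring
    have hA : ‖sharpAt G x‖ ^ 2 * ‖fderiv ℝ G x‖ ^ 2 ≤ b ^ 4 := by
      calc _ ≤ b ^ 2 * b ^ 2 := e1
        _ = b ^ 4 := by ring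
    have hB : ‖sharpAt G x‖ * ‖fderiv ℝ (fderiv ℝ G) x‖ ≤ b ^ 4 := e2.trans hb2
    have hC3 : (2⁻¹ * (‖sharpAt G x‖ * (3 * ‖fderiv ℝ G x‖))) ^ 2 ≤ (9 / 4) * b ^ 4 := by
      calc _ ≤ (2⁻¹ * (b * (3 * b))) ^ 2 := e3'
        _ = (9 / 4) * b ^ 4 := by ring
    have hb4 : 0 ≤ b ^ 4 := by positivity
    rw [hM]
    linarith
  have hM0 : 0 ≤ M := by rw [hM]; positivity
  refine opNorm_le_bound₂ _ (by positivity) fun Y Z ↦ ?_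
  rw [Real.norm_eq_abs]
  calc |ricAt G x Y Z| ≤ Module.finrank ℝ E * (M * ‖Y‖ * ‖Z‖) := hG.abs_ricAt_le hx Y Z
    _ ≤ Module.finrank ℝ E * (11 * b ^ 4 * ‖Y‖ * ‖Z‖) := by gcongr
    _ = 11 * Module.finrank ℝ E * b ^ 4 * ‖Y‖ * ‖Z‖ := by ring

/-- **Operator-norm form of the `C²` perturbation estimate for the Ricci form.**
[cite: Kotschwar2014, §1.1 (5)–(8)] -/
theorem opNorm_ricAt_sub_le (hG : IsMetricOn G V) (hG' : IsMetricOn G' V) (hx : x ∈ V)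
    {N : ℝ} (hN : 1 ≤ N) (hs : ‖sharpAt G x‖ ≤ N) (hs' : ‖sharpAt G' x‖ ≤ N)
    (h1 : ‖fderiv ℝ G x‖ ≤ N) (h1' : ‖fderiv ℝ G' x‖ ≤ N) (h2 : ‖fderiv ℝ (fderiv ℝ G) x‖ ≤ N) :
    ‖ricAt G x - ricAt G' x‖ ≤ 21 * Module.finrank ℝ E * N ^ 5 *
      (‖G x - G' x‖ + ‖fderiv ℝ G x - fderiv ℝ G' x‖
        + ‖fderiv ℝ (fderiv ℝ G) x - fderiv ℝ (fderiv ℝ G') x‖) := by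
  have hN0 : 0 ≤ N := zero_le_one.trans hN
  refine opNorm_le_bound₂ _ (by positivity) fun Y Z ↦ ?_
  rw [Real.norm_eq_abs, _root_.sub_apply, _root_.sub_apply]
  exact hG.abs_ricAt_sub_le hG' hx hN hs hs' h1 h1' h2 Y Z

/-! ### The pointwise estimate of the `C`-normalization -/

set_option maxHeartbeats 1600000 in
/-- **Pointwise estimate for the `C`-normalization** (Bär–Hanke 2023, §3, Prop. 23, endpoint
version, formula (9) in coordinates). Let `P = g_t`, `Q = g^A_t` be metric components on `V ∋ x`
with `‖♯_P‖, ‖DP‖, ‖D²P‖ ≤ b`, forms `h, h'` (first time derivatives), `hdd` (second time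
derivative of `g` at `t`), `hdd₋` (at `−t`), `A₀ = g_0(x)`, all of norm `≤ b` resp. with
`‖A₀ − P x‖ ≤ 3bt`, and suppose the perturbation sizes
`‖Q − P‖, ‖DQ − DP‖, ‖D²Q − D²P‖ ≤ 2b(1+C)t²`, `‖h' − h‖ ≤ 4b(1+C)t`, and that the second time
derivative of `g^A` is `hdd + r + θ (−hdd − hdd₋ − 2C A₀)` with `‖r‖ ≤ 6ηb(1+C)`. If
`4b²(1+C)t² ≤ 1`, `(1+C)t ≤ 1`, `40b²t ≤ 1`, `0 < t ≤ 1`, `0 ≤ η`, `0 ≤ θ`, then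
`𝒮(Q) ≥ 𝒮(P) − 8500 n² b⁸ (1+C)(t+η) + θ (C n − 4 n b²)` for
`𝒮(P) = scalAt P x + 3|½h|²_P − (tr_P ½h)² − tr_P hdd`. [cite: BarHanke2023, §3, Prop. 23 and (9)] -/
theorem stepA_pointwise {P Q : E → E →L[ℝ] E →L[ℝ] ℝ} (hP : IsMetricOn P V) (hQ : IsMetricOn Q V)
    (hx : x ∈ V) {b t C η θ : ℝ} (hb : 1 ≤ b) (ht0 : 0 < t) (ht1 : t ≤ 1) (hC : 0 ≤ C)
    (hη0 : 0 ≤ η) (hθ0 : 0 ≤ θ)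
    (hsmall₁ : 4 * b ^ 2 * (1 + C) * t ^ 2 ≤ 1) (hsmall₂ : (1 + C) * t ≤ 1)
    (hsmall₃ : 40 * b ^ 2 * t ≤ 1)
    (hs : ‖sharpAt P x‖ ≤ b) (h1 : ‖fderiv ℝ P x‖ ≤ b) (h2 : ‖fderiv ℝ (fderiv ℝ P) x‖ ≤ b)
    {hh hh' hdd hddm r A₀ : E →L[ℝ] E →L[ℝ] ℝ} (hhh : ‖hh‖ ≤ b) (hhdd : ‖hdd‖ ≤ b) (hhddm : ‖hddm‖ ≤ b)
    (hd0 : ‖Q x - P x‖ ≤ 2 * b * (1 + C) * t ^ 2)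
    (hd1 : ‖fderiv ℝ Q x - fderiv ℝ P x‖ ≤ 2 * b * (1 + C) * t ^ 2)
    (hd2 : ‖fderiv ℝ (fderiv ℝ Q) x - fderiv ℝ (fderiv ℝ P) x‖ ≤ 2 * b * (1 + C) * t ^ 2)
    (hdh : ‖hh' - hh‖ ≤ 4 * b * (1 + C) * t) (hr : ‖r‖ ≤ 6 * η * b * (1 + C))
    (hA₀ : ‖A₀ - P x‖ ≤ 3 * b * t) :
    scalAt P x + 3 * normSqAt P x ((2⁻¹ : ℝ) • hh) - mtrAt P x ((2⁻¹ : ℝ) • hh) ^ 2 - mtrAt P x hdd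
        - 8500 * (Module.finrank ℝ E) ^ 2 * b ^ 8 * (1 + C) * (t + η)
        + θ * (C * Module.finrank ℝ E - 4 * Module.finrank ℝ E * b ^ 2) ≤
      scalAt Q x + 3 * normSqAt Q x ((2⁻¹ : ℝ) • hh') - mtrAt Q x ((2⁻¹ : ℝ) • hh') ^ 2
        - mtrAt Q x (hdd + r + θ • (-hdd - hddm - (2 * C) • A₀)) := by
  -- abbreviations and signs
  set n : ℝ := (Module.finrank ℝ E : ℝ) with hn
  have hn0 : 0 ≤ n := Nat.cast_nonneg _
  have hn1 : n ≤ n ^ 2 := by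
    rcases Nat.eq_zero_or_pos (Module.finrank ℝ E) with h0 | hpos
    · simp [hn, h0]
    · have : (1 : ℝ) ≤ n := by rw [hn]; exact_mod_cast hpos
      nlinarith
  have hb0 : 0 ≤ b := zero_le_one.trans hb
  have hb1 : 1 ≤ b ^ 2 := one_le_pow₀ hb
  have hC1 : 1 ≤ 1 + C := by linarith
  have hC0 : 0 ≤ 1 + C := by linarith
  have hiP : (P x).IsInvertible := hP.isInvertible x hx
  have hiQ : (Q x).IsInvertible := hQ.isInvertible x hx
  set d : ℝ := 2 * b * (1 + C) * t ^ 2 with hd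
  have hd_nonneg : 0 ≤ d := by positivity
  have hdt : d ≤ 2 * b * t := by
    -- `(1+C) t² ≤ t` since `(1+C) t ≤ 1`
    have : (1 + C) * t ^ 2 ≤ t := by nlinarith
    calc d = 2 * b * ((1 + C) * t ^ 2) := by rw [hd]; ring
      _ ≤ 2 * b * t := by gcongr
  have hdb : b * d ≤ 2⁻¹ := by
    calc b * d = 2⁻¹ * (4 * b ^ 2 * (1 + C) * t ^ 2) := by rw [hd]; ring
      _ ≤ 2⁻¹ * 1 := by gcongr
      _ = 2⁻¹ := by ring
  -- (a) the inverse metrics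
  have hsQ : ‖sharpAt Q x‖ ≤ 2 * b := by
    have hsmall : ‖sharpAt P x‖ * ‖P x - Q x‖ ≤ 2⁻¹ := by
      rw [norm_sub_rev]
      calc ‖sharpAt P x‖ * ‖Q x - P x‖ ≤ b * d := by gcongr
        _ ≤ 2⁻¹ := hdb
    exact (norm_sharpAt_le_two_mul_of_small hiP hiQ hsmall).trans (by linarith)
  have hsQP : ‖sharpAt Q x - sharpAt P x‖ ≤ 4 * b ^ 3 * (1 + C) * t ^ 2 := by
    calc ‖sharpAt Q x - sharpAt P x‖ ≤ ‖sharpAt Q x‖ * ‖Q x - P x‖ * ‖sharpAt P x‖ :=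
          norm_sharpAt_sub_le hiQ hiP
      _ ≤ (2 * b) * d * b := by gcongr
      _ = 4 * b ^ 3 * (1 + C) * t ^ 2 := by rw [hd]; ring
  have hsQP' : ‖sharpAt Q x - sharpAt P x‖ ≤ 4 * b ^ 3 * (1 + C) * t := by
    refine hsQP.trans ?_
    have : t ^ 2 ≤ t := by nlinarith
    gcongr
  -- (b) the Ricci forms and the scalar curvatures
  have hN : (1 : ℝ) ≤ 2 * b := by linarith
  have h2t : 2 * t ≤ 1 := by nlinarith
  have hdb' : d ≤ b := by
    calc d ≤ 2 * b * t := hdt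
      _ = b * (2 * t) := by ring
      _ ≤ b * 1 := by gcongr
      _ = b := mul_one b
  have h1Q : ‖fderiv ℝ Q x‖ ≤ 2 * b := by
    have h := norm_le_insert' (fderiv ℝ Q x) (fderiv ℝ P x)
    linarith
  have h2Q : ‖fderiv ℝ (fderiv ℝ Q) x‖ ≤ 2 * b := by
    have h := norm_le_insert' (fderiv ℝ (fderiv ℝ Q) x) (fderiv ℝ (fderiv ℝ P) x)
    linarith
  have hricP : ‖ricAt P x‖ ≤ 11 * n * b ^ 4 := opNorm_ricAt_le hP hx hb hs h1 h2
  have hricQP : ‖ricAt Q x - ricAt P x‖ ≤ 4032 * n * b ^ 6 * (1 + C) * t ^ 2 := by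
    have h := opNorm_ricAt_sub_le hQ hP hx hN hsQ (hs.trans (by linarith)) h1Q
      (h1.trans (by linarith)) h2Q
    calc ‖ricAt Q x - ricAt P x‖
        ≤ 21 * n * (2 * b) ^ 5 * (‖Q x - P x‖ + ‖fderiv ℝ Q x - fderiv ℝ P x‖ +
            ‖fderiv ℝ (fderiv ℝ Q) x - fderiv ℝ (fderiv ℝ P) x‖) := h
      _ ≤ 21 * n * (2 * b) ^ 5 * (d + d + d) := by gcongr
      _ = 4032 * n * b ^ 6 * (1 + C) * t ^ 2 := by rw [hd]; ring
  have hricQ : ‖ricAt Q x‖ ≤ 1019 * n * b ^ 4 := by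
    have h := norm_le_insert' (ricAt Q x) (ricAt P x)
    have : 4032 * n * b ^ 6 * (1 + C) * t ^ 2 ≤ 1008 * n * b ^ 4 := by
      calc 4032 * n * b ^ 6 * (1 + C) * t ^ 2
          = 1008 * n * b ^ 4 * (4 * b ^ 2 * (1 + C) * t ^ 2) := by ring
        _ ≤ 1008 * n * b ^ 4 * 1 := by gcongr
        _ = 1008 * n * b ^ 4 := by ring
    linarith
  have hscal : |scalAt Q x - scalAt P x| ≤ 8108 * n ^ 2 * b ^ 7 * (1 + C) * t ^ 2 := by
    unfold scalAt
    calc |mtrAt Q x (ricAt Q x) - mtrAt P x (ricAt P x)|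
        ≤ n * (‖sharpAt Q x - sharpAt P x‖ * ‖ricAt Q x‖ + ‖sharpAt P x‖ * ‖ricAt Q x - ricAt P x‖) :=
          abs_mtrAt_sub_mtrAt_le Q P x _ _
      _ ≤ n * ((4 * b ^ 3 * (1 + C) * t ^ 2) * (1019 * n * b ^ 4) +
          b * (4032 * n * b ^ 6 * (1 + C) * t ^ 2)) := by gcongr
      _ = 8108 * n ^ 2 * b ^ 7 * (1 + C) * t ^ 2 := by ring
  -- (c) the first-order terms
  have hhh' : ‖hh'‖ ≤ 5 * b := by
    have h := norm_le_insert' hh' hh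
    have : 4 * b * (1 + C) * t ≤ 4 * b := by
      calc 4 * b * (1 + C) * t = 4 * b * ((1 + C) * t) := by ring
        _ ≤ 4 * b * 1 := by gcongr
        _ = 4 * b := by ring
    linarith
  have hβ : ‖(2⁻¹ : ℝ) • hh‖ ≤ 2⁻¹ * b := by rw [norm_smul, Real.norm_eq_abs, abs_of_pos (by norm_num)]; gcongr
  have hβ' : ‖(2⁻¹ : ℝ) • hh'‖ ≤ 2⁻¹ * (5 * b) := by
    rw [norm_smul, Real.norm_eq_abs, abs_of_pos (by norm_num)]; gcongr
  have hββ' : ‖(2⁻¹ : ℝ) • hh' - (2⁻¹ : ℝ) • hh‖ ≤ 2 * b * (1 + C) * t := by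
    rw [← smul_sub, norm_smul, Real.norm_eq_abs, abs_of_pos (by norm_num)]
    linarith
  have hdcommon : ‖sharpAt Q x - sharpAt P x‖ * ‖(2⁻¹ : ℝ) • hh'‖ +
      ‖sharpAt P x‖ * ‖(2⁻¹ : ℝ) • hh' - (2⁻¹ : ℝ) • hh‖ ≤ 12 * b ^ 4 * (1 + C) * t := by
    calc _ ≤ (4 * b ^ 3 * (1 + C) * t) * (2⁻¹ * (5 * b)) + b * (2 * b * (1 + C) * t) := by gcongr
      _ = (10 * b ^ 4 + 2 * b ^ 2) * ((1 + C) * t) := by ring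
      _ ≤ (10 * b ^ 4 + 2 * b ^ 4) * ((1 + C) * t) := by
          gcongr
          nlinarith
      _ = 12 * b ^ 4 * (1 + C) * t := by ring
  have hns : |normSqAt Q x ((2⁻¹ : ℝ) • hh') - normSqAt P x ((2⁻¹ : ℝ) • hh)| ≤
      66 * n * b ^ 6 * (1 + C) * t := by
    calc _ ≤ n * ((‖sharpAt Q x - sharpAt P x‖ * ‖(2⁻¹ : ℝ) • hh'‖ +
          ‖sharpAt P x‖ * ‖(2⁻¹ : ℝ) • hh' - (2⁻¹ : ℝ) • hh‖) *
          (‖sharpAt Q x‖ * ‖(2⁻¹ : ℝ) • hh'‖ + ‖sharpAt P x‖ * ‖(2⁻¹ : ℝ) • hh‖)) :=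
          abs_normSqAt_sub_normSqAt_le Q P x _ _
      _ ≤ n * ((12 * b ^ 4 * (1 + C) * t) * ((2 * b) * (2⁻¹ * (5 * b)) + b * (2⁻¹ * b))) := by
          gcongr
      _ = 66 * n * b ^ 6 * (1 + C) * t := by ring
  have hmP : |mtrAt P x ((2⁻¹ : ℝ) • hh)| ≤ 2⁻¹ * n * b ^ 2 := by
    calc _ ≤ n * (‖sharpAt P x‖ * ‖(2⁻¹ : ℝ) • hh‖) := abs_mtrAt_le P x _
      _ ≤ n * (b * (2⁻¹ * b)) := by gcongr
      _ = 2⁻¹ * n * b ^ 2 := by ring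
  have hmQP : |mtrAt Q x ((2⁻¹ : ℝ) • hh') - mtrAt P x ((2⁻¹ : ℝ) • hh)| ≤
      12 * n * b ^ 4 * (1 + C) * t := by
    calc _ ≤ n * (‖sharpAt Q x - sharpAt P x‖ * ‖(2⁻¹ : ℝ) • hh'‖ +
          ‖sharpAt P x‖ * ‖(2⁻¹ : ℝ) • hh' - (2⁻¹ : ℝ) • hh‖) := abs_mtrAt_sub_mtrAt_le Q P x _ _
      _ ≤ n * (12 * b ^ 4 * (1 + C) * t) := by gcongr
      _ = 12 * n * b ^ 4 * (1 + C) * t := by ring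
  have hsq : |mtrAt Q x ((2⁻¹ : ℝ) • hh') ^ 2 - mtrAt P x ((2⁻¹ : ℝ) • hh) ^ 2| ≤
      162 * n ^ 2 * b ^ 8 * (1 + C) * t := by
    set mQ := mtrAt Q x ((2⁻¹ : ℝ) • hh') with hmQdef
    set mP' := mtrAt P x ((2⁻¹ : ℝ) • hh) with hmPdef
    have ht' : 12 * n * b ^ 4 * (1 + C) * t ≤ 12 * n * b ^ 4 := by
      calc 12 * n * b ^ 4 * (1 + C) * t = 12 * n * b ^ 4 * ((1 + C) * t) := by ring
        _ ≤ 12 * n * b ^ 4 * 1 := by gcongr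
        _ = 12 * n * b ^ 4 := by ring
    have hb24 : n * b ^ 2 ≤ n * b ^ 4 :=
      mul_le_mul_of_nonneg_left (pow_le_pow_right₀ hb (by norm_num)) hn0
    have hnb4' : 0 ≤ n * b ^ 4 := by positivity
    have hmP4 : |mP'| ≤ 2⁻¹ * n * b ^ 4 := by linarith
    have hmQ : |mQ| ≤ 13 * n * b ^ 4 := by
      have h := abs_sub_abs_le_abs_sub mQ mP'
      linarith
    rw [sq_sub_sq, abs_mul]
    have hsum : |mQ + mP'| ≤ 27 / 2 * n * b ^ 4 := by
      have h := abs_add_le mQ mP'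
      linarith
    calc |mQ + mP'| * |mQ - mP'| ≤ (27 / 2 * n * b ^ 4) * (12 * n * b ^ 4 * (1 + C) * t) := by
          gcongr
      _ = 162 * n ^ 2 * b ^ 8 * (1 + C) * t := by ring
  -- (d) the second-order term
  have htrQ1 : |mtrAt Q x hdd - mtrAt P x hdd| ≤ 4 * n * b ^ 4 * (1 + C) * t := by
    calc _ ≤ n * (‖sharpAt Q x - sharpAt P x‖ * ‖hdd‖ + ‖sharpAt P x‖ * ‖hdd - hdd‖) :=
          abs_mtrAt_sub_mtrAt_le Q P x _ _
      _ = n * (‖sharpAt Q x - sharpAt P x‖ * ‖hdd‖) := by rw [sub_self, norm_zero, mul_zero, add_zero]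
      _ ≤ n * ((4 * b ^ 3 * (1 + C) * t) * b) := by gcongr
      _ = 4 * n * b ^ 4 * (1 + C) * t := by ring
  have htrQr : |mtrAt Q x r| ≤ 12 * n * b ^ 2 * (1 + C) * η := by
    calc _ ≤ n * (‖sharpAt Q x‖ * ‖r‖) := abs_mtrAt_le Q x r
      _ ≤ n * ((2 * b) * (6 * η * b * (1 + C))) := by gcongr
      _ = 12 * n * b ^ 2 * (1 + C) * η := by ring
  have htrQhdd : |mtrAt Q x hdd| ≤ 2 * n * b ^ 2 := by
    calc _ ≤ n * (‖sharpAt Q x‖ * ‖hdd‖) := abs_mtrAt_le Q x _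
      _ ≤ n * ((2 * b) * b) := by gcongr
      _ = 2 * n * b ^ 2 := by ring
  have htrQhddm : |mtrAt Q x hddm| ≤ 2 * n * b ^ 2 := by
    calc _ ≤ n * (‖sharpAt Q x‖ * ‖hddm‖) := abs_mtrAt_le Q x _
      _ ≤ n * ((2 * b) * b) := by gcongr
      _ = 2 * n * b ^ 2 := by ring
  have htrA₀ : n - 10 * n * b ^ 2 * t ≤ mtrAt Q x A₀ := by
    have hsplit : mtrAt Q x A₀ = mtrAt Q x (Q x) + mtrAt Q x (A₀ - Q x) := by
      rw [← mtrAt_add]; congr 1; abel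
    have hself : mtrAt Q x (Q x) = n := mtrAt_self hiQ
    have hrest : |mtrAt Q x (A₀ - Q x)| ≤ 10 * n * b ^ 2 * t := by
      have hAQ : ‖A₀ - Q x‖ ≤ 5 * b * t := by
        calc ‖A₀ - Q x‖ = ‖(A₀ - P x) - (Q x - P x)‖ := by congr 1; abel
          _ ≤ ‖A₀ - P x‖ + ‖Q x - P x‖ := norm_sub_le _ _
          _ ≤ 3 * b * t + d := by gcongr
          _ ≤ 3 * b * t + 2 * b * t := by gcongr
          _ = 5 * b * t := by ring
      calc _ ≤ n * (‖sharpAt Q x‖ * ‖A₀ - Q x‖) := abs_mtrAt_le Q x _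
        _ ≤ n * ((2 * b) * (5 * b * t)) := by gcongr
        _ = 10 * n * b ^ 2 * t := by ring
    rw [hsplit, hself]
    linarith [(abs_le.1 hrest).1]
  have hX : mtrAt Q x (hdd + r + θ • (-hdd - hddm - (2 * C) • A₀)) =
      mtrAt Q x hdd + mtrAt Q x r + θ * (-mtrAt Q x hdd - mtrAt Q x hddm - 2 * C * mtrAt Q x A₀) := by
    rw [mtrAt_add, mtrAt_add, mtrAt_smul, mtrAt_sub, mtrAt_sub, mtrAt_neg, mtrAt_smul]
  -- (e) assemble
  have hθC : θ * (-mtrAt Q x hdd - mtrAt Q x hddm - 2 * C * mtrAt Q x A₀) ≤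
      -(θ * (C * n - 4 * n * b ^ 2)) := by
    rw [← mul_neg]
    refine mul_le_mul_of_nonneg_left ?_ hθ0
    have hA : 2 * C * (n - 10 * n * b ^ 2 * t) ≤ 2 * C * mtrAt Q x A₀ := by gcongr
    have hsm : 20 * C * n * b ^ 2 * t ≤ C * n := by
      have : 40 * b ^ 2 * t * (C * n) ≤ 1 * (C * n) := by gcongr
      nlinarith
    linarith [(abs_le.1 htrQhdd).1, (abs_le.1 htrQhddm).1]
  have ht2t : t ^ 2 ≤ t := by nlinarith
  have e1 := (abs_le.1 hscal).1
  have e2 := abs_le.1 hns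
  have e3 := abs_le.1 hsq
  have e4 := abs_le.1 htrQ1
  have e5 := abs_le.1 htrQr
  rw [hX]
  -- the total error
  have hb7 : b ^ 7 ≤ b ^ 8 := pow_le_pow_right₀ hb (by norm_num)
  have hb6 : b ^ 6 ≤ b ^ 8 := pow_le_pow_right₀ hb (by norm_num)
  have hb4 : b ^ 4 ≤ b ^ 8 := pow_le_pow_right₀ hb (by norm_num)
  have hb2 : b ^ 2 ≤ b ^ 8 := pow_le_pow_right₀ hb (by norm_num)
  have hnb6 : n * b ^ 6 ≤ n ^ 2 * b ^ 8 := mul_le_mul hn1 hb6 (by positivity) (by positivity)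
  have hnb4 : n * b ^ 4 ≤ n ^ 2 * b ^ 8 := mul_le_mul hn1 hb4 (by positivity) (by positivity)
  have hnb2 : n * b ^ 2 ≤ n ^ 2 * b ^ 8 := mul_le_mul hn1 hb2 (by positivity) (by positivity)
  have t1 : 8108 * n ^ 2 * b ^ 7 * (1 + C) * t ^ 2 ≤ 8108 * n ^ 2 * b ^ 8 * (1 + C) * t := by
    gcongr
  have t2 : 3 * (66 * n * b ^ 6 * (1 + C) * t) ≤ 198 * n ^ 2 * b ^ 8 * (1 + C) * t := by
    calc 3 * (66 * n * b ^ 6 * (1 + C) * t) = 198 * (n * b ^ 6) * ((1 + C) * t) := by ring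
      _ ≤ 198 * (n ^ 2 * b ^ 8) * ((1 + C) * t) := by gcongr
      _ = 198 * n ^ 2 * b ^ 8 * (1 + C) * t := by ring
  have t4 : 4 * n * b ^ 4 * (1 + C) * t ≤ 4 * n ^ 2 * b ^ 8 * (1 + C) * t := by
    calc 4 * n * b ^ 4 * (1 + C) * t = 4 * (n * b ^ 4) * ((1 + C) * t) := by ring
      _ ≤ 4 * (n ^ 2 * b ^ 8) * ((1 + C) * t) := by gcongr
      _ = 4 * n ^ 2 * b ^ 8 * (1 + C) * t := by ring
  have t5 : 12 * n * b ^ 2 * (1 + C) * η ≤ 12 * n ^ 2 * b ^ 8 * (1 + C) * η := by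
    calc 12 * n * b ^ 2 * (1 + C) * η = 12 * (n * b ^ 2) * ((1 + C) * η) := by ring
      _ ≤ 12 * (n ^ 2 * b ^ 8) * ((1 + C) * η) := by gcongr
      _ = 12 * n ^ 2 * b ^ 8 * (1 + C) * η := by ring
  have hpos_t : 0 ≤ n ^ 2 * b ^ 8 * (1 + C) * t := by positivity
  have hpos_η : 0 ≤ n ^ 2 * b ^ 8 * (1 + C) * η := by positivity
  have herr : 8108 * n ^ 2 * b ^ 7 * (1 + C) * t ^ 2 + 3 * (66 * n * b ^ 6 * (1 + C) * t) +
      162 * n ^ 2 * b ^ 8 * (1 + C) * t + 4 * n * b ^ 4 * (1 + C) * t +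
      12 * n * b ^ 2 * (1 + C) * η ≤ 8500 * n ^ 2 * b ^ 8 * (1 + C) * (t + η) := by
    linarith [t1, t2, t4, t5, hpos_t, hpos_η]
  linarith [e1, e2.1, e2.2, e3.1, e3.2, e4.1, e4.2, e5.1, e5.2, hθC, herr]

end MetricCoord

end Literature.Geometry.Lorentzian
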